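import Literature.AlgebraicGeometry.Resolution.AlterationsFormalNodesHolds
import Summits.ResolutionOfSingularities.ResolutionOfSingularities.Theorems.WildQuotientsSummitReductionStubPairNodeThickness
import HarnessLib

/-!
# `WildQuotients.SummitReduction` (stmt-ResolutionOfSingularities-16324), line `FramePerfect`, skeleton v8:
# stub `stub_pair_quasiSplitNormalForm` (N) — helper file 2: de Jong 1996, 2.23 + 3.3 at a QUASI-SPLIT
# point, over an arbitrary field (the tree's `DeJong1996SplitNodalStructure` without `IsAlgClosed`)

Route `ResolutionOfSingularities/WildQuotients`, crux `SummitReduction`; sub-goals of the registered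
stub `stub_pair_quasiSplitNormalForm` of the line skeleton `Cruxes/SummitReduction/Lines/FramePerfect.lean`
(v8, lead c4). Worker file.

The tree discharges de Jong 1996, 2.23 with 3.3 ("The complete local ring of `X` at `x` is
`B ≅ A⟦u, v⟧/(uv - h)` … `h = ε t₁^{n₁} ⋯ t_r^{n_r}`", pp. 61–63) at a CLOSED point of `Sing(f)` of a
pair in Situation 4.23 over an ALGEBRAICALLY CLOSED field as `DeJong1996SplitNodalStructure_holds`
(`AlterationsFormalNodesHolds.lean`): `𝒪̂_{X,x} ≅ k⟦u, v, T₁, …, T_m⟧/(uv - ∏ Tᵢ^{νᵢ})` with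
`f^#(tᵢ) ↦ Tᵢ`. Algebraic closedness is used for exactly two inputs of 2.23 — the residue fields
of `x` and `f x` agree, and the completed fibre ring is the formal node `k⟦u, v⟧/(uv)` — and for the
coefficient field `k` of Cohen's theorem. For the QUASI-SPLIT semi-stable curves of de Jong 1997,
5.7 (the line `FramePerfect`), the quasi-split datum at `x` — an isomorphism
`(𝒪_{X,x}/𝔪_{f x}𝒪_{X,x})^ ≅ κ(f x)⟦u, v⟧/(uv)` over `κ(f x)` — supplies both inputs
(`exists_sub_mem_maximalIdeal_of_quasiSplit` of the hT file, and itself), and Cohen's theorem is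
applied with the coefficient field `κ = κ(f x)` of `𝒪̂_{Y,f x}` (which contains the ground field).
This file re-runs the tree's discharge with these replacements, for an ARBITRARY point `x` carrying
a quasi-split datum (no closedness, no algebraic closedness):

* `exists_ringEquiv_nodeDeformationRing_of_quasiSplit` — 2.23: `Â⟦u, v⟧/(uv - h) ≅ B̂` over `Â`
  (Liu 2002, 10.3.20, `NodalDeformation.exists_ringEquiv_cpl`);
* `exists_ringEquiv_adicCompletion_stalk_mvPowerSeries_residueField` — Cohen coordinates
  `𝒪̂_{Y,y} ≅ κ(y)⟦T₁, …, T_m⟧`, `zᵢ ↦ Tᵢ`, for a scheme over a field;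
* `exists_ringEquiv_nodeDeformationRing_cohen_of_quasiSplit` — 2.23 on Cohen coordinates;
* `not_isDomain_nodalRing`, `false_of_nodal_completion_of_le`, `map_maximalIdeal_ne_of_quasiSplit`
  — a quasi-split datum forces `𝔪_{f x}𝒪_{X,x} ≠ 𝔪_x` (the formal node is not a domain).
The 3.3 half (`h = ε ∏ Tᵢ^{nᵢ}`) and the assembled nodal structure are in the continuation
`…StubPairQuasiSplitNormalFormLemmas3.lean`.
-/

set_option linter.dupNamespace false

noncomputable section

open CategoryTheory CategoryTheory.Limits AlgebraicGeometry TopologicalSpace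
open Literature.AlgebraicGeometry.Resolution
open Literature.AlgebraicGeometry
open IsLocalRing NodalDeformation Scheme.IdealSheafData

namespace Summit.ResolutionOfSingularities.ResolutionOfSingularities.Theorems

universe u

/-! ## 2.23 at a quasi-split point -/

/-- **de Jong 1996, 2.23 at a quasi-split point of `Sing(f)`**: for a FLAT local homomorphism
`A → B` of Noetherian local rings whose closed fibre `B/𝔪_A B` has completion the formal node
`κ(A)⟦u, v⟧/(uv)` over `κ(A)` (the quasi-split datum), there are `h ∈ 𝔪_Â` and an isomorphism
`Â⟦u, v⟧/(uv - h) ≅ B̂` over `Â → B̂`: the residue fields agree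
(`exists_sub_mem_maximalIdeal_of_quasiSplit`), so Liu 2002, Lemma 10.3.20
(`NodalDeformation.exists_ringEquiv_cpl`) applies. [cite: DeJong1996, 2.23, pp. 61–62] -/
theorem exists_ringEquiv_nodeDeformationRing_of_quasiSplit {A B : Type u} [CommRing A] [CommRing B]
    [IsLocalRing A] [IsLocalRing B] [IsNoetherianRing A] [IsNoetherianRing B] [Algebra A B]
    [IsLocalHom (algebraMap A B)] (hflat : (algebraMap A B).Flat)
    (e : AdicCompletion ((maximalIdeal B).map (Ideal.Quotient.mk
          ((maximalIdeal A).map (algebraMap A B)))) (B ⧸ (maximalIdeal A).map (algebraMap A B)) ≃+*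
      MvPowerSeries (Fin 2) (A ⧸ maximalIdeal A) ⧸
        Ideal.span {(MvPowerSeries.X 0 * MvPowerSeries.X 1 :
          MvPowerSeries (Fin 2) (A ⧸ maximalIdeal A))})
    (he : e.toRingHom.comp ((algebraMap (B ⧸ (maximalIdeal A).map (algebraMap A B)) _).comp
        (Ideal.quotientMap ((maximalIdeal A).map (algebraMap A B)) (algebraMap A B)
          Ideal.le_comap_map)) =
      algebraMap (A ⧸ maximalIdeal A) _) :
    ∃ (h : Cpl A) (e' : DeJong1996.NodeDeformationRing (Cpl A) h ≃+* Cpl B),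
      h ∈ maximalIdeal (Cpl A) ∧
      ∀ a, e' (Ideal.Quotient.mk _ (MvPowerSeries.C a)) = complMap (algebraMap A B) a := by
  have hres' := exists_sub_mem_maximalIdeal_of_quasiSplit (algebraMap A B) e he
  have hres : Function.Surjective ((residue B).comp (algebraMap A B)) := by
    intro r
    obtain ⟨b, rfl⟩ := residue_surjective r
    obtain ⟨a, ha⟩ := hres' b
    refine ⟨a, ?_⟩
    rw [RingHom.comp_apply]
    show Ideal.Quotient.mk _ _ = Ideal.Quotient.mk _ _
    rw [Ideal.Quotient.mk_eq_mk_iff_sub_mem, ← neg_sub]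
    exact Submodule.neg_mem _ ha
  exact NodalDeformation.exists_ringEquiv_cpl (algebraMap A B) hres hflat e

/-! ## Cohen coordinates over the residue field -/

/-- **Cohen coordinates at a regular point of a scheme over a field, with the residue field as
coefficient field**: for `Y → Spec k`, a point `y` with `𝒪_{Y,y}` regular of dimension `d`, and
generators `z₁, …, z_d` of `𝔪_y`, there is `e : 𝒪̂_{Y,y} ≃+* κ(y)⟦X₁, …, X_d⟧` with `e(zᵢ) = Xᵢ`
(`exists_ringEquiv_adicCompletion_mvPowerSeries_of_rsop` with the field `k ⊆ 𝒪_{Y,y}` and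
`K = κ(y)` the residue field of `𝒪_{Y,y}`; Matsumura, Thm. 29.7). [cite: Matsumura1987, Thm. 29.7] -/
theorem exists_ringEquiv_adicCompletion_stalk_mvPowerSeries_residueField {k : Type u} [Field k]
    {Y : Scheme.{u}} (g : Y ⟶ Spec (.of k)) (y : Y) [IsRegularLocalRing (Y.presheaf.stalk y)]
    {d : ℕ} (z : Fin d → Y.presheaf.stalk y)
    (hz : Ideal.span (Set.range z) = maximalIdeal (Y.presheaf.stalk y))
    (hd : ringKrullDim (Y.presheaf.stalk y) = d) :
    ∃ e : AdicCompletion (maximalIdeal (Y.presheaf.stalk y)) (Y.presheaf.stalk y) ≃+*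
        MvPowerSeries (Fin d) (ResidueField (Y.presheaf.stalk y)),
      ∀ i, e (algebraMap _ _ (z i)) = MvPowerSeries.X i := by
  -- the field `k` inside `𝒪_{Y,y}`: `k = Γ(Spec k) → Γ(Y) → 𝒪_{Y,y}`
  let φ : k →+* Y.presheaf.stalk y :=
    (Y.presheaf.germ ⊤ y trivial).hom.comp
      (g.appTop.hom.comp (Scheme.ΓSpecIso (.of k)).inv.hom)
  have hφ : Function.Injective φ := φ.injective
  let k₀ : Subring (Y.presheaf.stalk y) := φ.range
  have hk₀ : IsField k₀ :=
    MulEquiv.isField (Field.toIsField k) (RingEquiv.ofBijective φ.rangeRestrict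
      ⟨fun a b h => hφ (congrArg Subtype.val h), φ.rangeRestrict_surjective⟩).symm.toMulEquiv
  exact exists_ringEquiv_adicCompletion_mvPowerSeries_of_rsop (Y.presheaf.stalk y) k₀ hk₀
    (RingEquiv.refl _) z hz hd

/-- The formal node `F⟦u, v⟧/(uv)` over a non-trivial commutative ring is not a domain
(`u · v = 0`, `u, v ≠ 0`; the tree's `IsOrdinaryDoublePoint.not_isDomain_quotient` for a
commutative coefficient ring, so that it applies to `κ(y) = 𝒪_{Y,y}/𝔪_y` literally). [folklore] -/
theorem not_isDomain_nodalRing (F : Type u) [CommRing F] [Nontrivial F] :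
    ¬ IsDomain (MvPowerSeries (Fin 2) F ⧸
      Ideal.span {(MvPowerSeries.X 0 * MvPowerSeries.X 1 : MvPowerSeries (Fin 2) F)}) := by
  set J : Ideal (MvPowerSeries (Fin 2) F) :=
    Ideal.span {(MvPowerSeries.X 0 * MvPowerSeries.X 1 : MvPowerSeries (Fin 2) F)} with hJ
  intro hD
  have hne : ∀ {i j : Fin 2}, i ≠ j → Ideal.Quotient.mk J (MvPowerSeries.X i) ≠ 0 := by
    intro i j hij h0
    rw [Ideal.Quotient.eq_zero_iff_mem, hJ, Ideal.mem_span_singleton] at h0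
    refine IsOrdinaryDoublePoint.not_X_dvd_X_of_ne hij (dvd_trans ?_ h0)
    fin_cases j
    · exact dvd_mul_right _ _
    · exact dvd_mul_left _ _
  have hzero : Ideal.Quotient.mk J (MvPowerSeries.X 0) * Ideal.Quotient.mk J (MvPowerSeries.X 1) =
      0 := by
    rw [← map_mul, Ideal.Quotient.eq_zero_iff_mem, hJ]
    exact Ideal.subset_span rfl
  rcases mul_eq_zero.mp hzero with h | h
  · exact hne (i := 0) (j := 1) (by decide) h
  · exact hne (i := 1) (j := 0) (by decide) h

/-- If the completion of `B/J` at the image of `𝔪_B` is the formal node over `κ(A)` for a prime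
`J ⊇ 𝔪_B`, contradiction: `B/J` is a domain, complete for the zero ideal `𝔪_B (B/J) = 0`.
[folklore] -/
theorem false_of_nodal_completion_of_le {A B : Type u} [CommRing A] [CommRing B]
    [IsLocalRing A] [IsLocalRing B] (J : Ideal B) [J.IsPrime] (hJ : maximalIdeal B ≤ J)
    (e' : AdicCompletion ((maximalIdeal B).map (Ideal.Quotient.mk J)) (B ⧸ J) ≃+*
        MvPowerSeries (Fin 2) (A ⧸ maximalIdeal A) ⧸
          Ideal.span {(MvPowerSeries.X 0 * MvPowerSeries.X 1 :
            MvPowerSeries (Fin 2) (A ⧸ maximalIdeal A))}) : False := by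
  have hI0 : (maximalIdeal B).map (Ideal.Quotient.mk J) = ⊥ := by
    rw [Ideal.map_eq_bot_iff_le_ker, Ideal.mk_ker]
    exact hJ
  haveI : IsAdicComplete ((maximalIdeal B).map (Ideal.Quotient.mk J)) (B ⧸ J) := by
    rw [hI0]
    infer_instance
  let e₀ := (AdicCompletion.ofAlgEquiv ((maximalIdeal B).map (Ideal.Quotient.mk J))).toRingEquiv
  have e₂ := e₀.trans e'
  haveI : Nontrivial (A ⧸ maximalIdeal A) :=
    Ideal.Quotient.nontrivial_iff.mpr (maximalIdeal.isMaximal A).ne_top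
  exact not_isDomain_nodalRing (A ⧸ maximalIdeal A)
    (Function.Injective.isDomain e₂.symm.toRingHom e₂.symm.injective)

/-- **A quasi-split node is not a point with field fibre ring**: if the completion of
`B/𝔪_A B` (at the image of `𝔪_B`) is the formal node `κ(A)⟦u, v⟧/(uv)`, then `𝔪_A B ≠ 𝔪_B` —
otherwise `B/𝔪_A B` is the field `κ(B)` and the formal node would be a domain.
[cite: DeJong1996, 2.23, pp. 61–62] -/
theorem map_maximalIdeal_ne_of_quasiSplit {A B : Type u} [CommRing A] [CommRing B]
    [IsLocalRing A] [IsLocalRing B] (ρ : A →+* B)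
    (e : AdicCompletion ((maximalIdeal B).map (Ideal.Quotient.mk ((maximalIdeal A).map ρ)))
        (B ⧸ (maximalIdeal A).map ρ) ≃+*
      MvPowerSeries (Fin 2) (A ⧸ maximalIdeal A) ⧸
        Ideal.span {(MvPowerSeries.X 0 * MvPowerSeries.X 1 :
          MvPowerSeries (Fin 2) (A ⧸ maximalIdeal A))}) :
    (maximalIdeal A).map ρ ≠ maximalIdeal B := by
  intro heq
  haveI : ((maximalIdeal A).map ρ).IsPrime := by
    rw [heq]
    infer_instance
  exact false_of_nodal_completion_of_le _ heq.ge e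

/-- **2.23 on Cohen coordinates at a quasi-split point.** For the curve of a pair in Situation
4.23 over any field, a point `x` with a quasi-split datum, and generators `z₁, …, z_m` of
`𝔪_{Y,f x}` (`m = dim 𝒪_{Y,f x}`): Cohen coordinates `eA : 𝒪̂_{Y,f x} ≅ Λ = κ(f x)⟦T₁, …, T_m⟧`,
`zᵢ ↦ Tᵢ`, a non-unit `h ∈ Λ` and `e : 𝒪̂_{X,x} ≅ Λ⟦u, v⟧/(uv - h)` with `e(f^# a) = C (eA â)` for
every `a ∈ 𝒪_{Y,f x}` (the tree's `exists_ringEquiv_nodeDeformationRing_cohen` with the quasi-split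
2.23 and the residue field as coefficient field). [cite: DeJong1996, 2.23, pp. 61–62] -/
theorem exists_ringEquiv_nodeDeformationRing_cohen_of_quasiSplit {k : Type u} [Field k]
    {X Y : Scheme.{u}} {f : X ⟶ Y} {g : Y ⟶ Spec (.of k)} {D : Set Y} {n : ℕ} {τ : Fin n → (Y ⟶ X)}
    (hS : DeJong1996.SemiStablePair f g D τ) {x : X}
    (e₁ : AdicCompletion
        ((maximalIdeal (X.presheaf.stalk x)).map (Ideal.Quotient.mk
          ((maximalIdeal (Y.presheaf.stalk (f x))).map (f.stalkMap x).hom)))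
        (X.presheaf.stalk x ⧸ (maximalIdeal (Y.presheaf.stalk (f x))).map (f.stalkMap x).hom) ≃+*
      MvPowerSeries (Fin 2) (Y.presheaf.stalk (f x) ⧸ maximalIdeal (Y.presheaf.stalk (f x))) ⧸
        Ideal.span {(MvPowerSeries.X 0 * MvPowerSeries.X 1 :
          MvPowerSeries (Fin 2) (Y.presheaf.stalk (f x) ⧸ maximalIdeal (Y.presheaf.stalk (f x))))})
    (he₁ : e₁.toRingHom.comp ((algebraMap (X.presheaf.stalk x ⧸
        (maximalIdeal (Y.presheaf.stalk (f x))).map (f.stalkMap x).hom) _).comp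
        (Ideal.quotientMap ((maximalIdeal (Y.presheaf.stalk (f x))).map (f.stalkMap x).hom)
          (f.stalkMap x).hom Ideal.le_comap_map)) =
      algebraMap (Y.presheaf.stalk (f x) ⧸ maximalIdeal (Y.presheaf.stalk (f x))) _)
    {m : ℕ} (z : Fin m → Y.presheaf.stalk (f x))
    (hz : Ideal.span (Set.range z) = maximalIdeal (Y.presheaf.stalk (f x)))
    (hm : ringKrullDim (Y.presheaf.stalk (f x)) = m) :
    ∃ (h : MvPowerSeries (Fin m) (ResidueField (Y.presheaf.stalk (f x))))
      (eA : AdicCompletion (maximalIdeal (Y.presheaf.stalk (f x))) (Y.presheaf.stalk (f x)) ≃+*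
        MvPowerSeries (Fin m) (ResidueField (Y.presheaf.stalk (f x))))
      (e : AdicCompletion (maximalIdeal (X.presheaf.stalk x)) (X.presheaf.stalk x) ≃+*
        DeJong1996.NodeDeformationRing (MvPowerSeries (Fin m) (ResidueField (Y.presheaf.stalk (f x)))) h),
      ¬ IsUnit h ∧ (∀ i, eA (algebraMap _ _ (z i)) = MvPowerSeries.X i) ∧
        ∀ a, e (algebraMap _ _ ((f.stalkMap x).hom a)) =
          Ideal.Quotient.mk _ (MvPowerSeries.C (eA (algebraMap _ _ a))) := by
  haveI := hS.isIntegral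
  haveI : IsNoetherian X := DeJong1996.isNoetherian_of_isProjectiveOver _ hS.isProjectiveOver
  haveI := hS.isNoetherian_base
  haveI : IsRegularLocalRing (Y.presheaf.stalk (f x)) := hS.isRegular_base (f x)
  -- the local rings `A → B`
  let A := Y.presheaf.stalk (f x)
  let B := X.presheaf.stalk x
  letI algAB : Algebra A B := (f.stalkMap x).hom.toAlgebra
  haveI : IsLocalHom (algebraMap A B) := inferInstanceAs (IsLocalHom (f.stalkMap x).hom)
  -- 2.23
  obtain ⟨h₀, e₀, hh₀, hC⟩ := exists_ringEquiv_nodeDeformationRing_of_quasiSplit (A := A) (B := B)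
    (hS.stalkMap_flat x) e₁ he₁
  -- Cohen coordinates on the base
  obtain ⟨eA, heA⟩ := exists_ringEquiv_adicCompletion_stalk_mvPowerSeries_residueField g (f x) z hz hm
  refine ⟨eA h₀, eA, e₀.symm.trans (DeJong1996.NodeDeformationRing.congr eA h₀ (eA h₀) rfl),
    fun hu => ((mem_maximalIdeal _).mp hh₀) (by simpa using hu.map eA.symm), heA, fun a => ?_⟩
  have h1 : algebraMap _ (AdicCompletion (maximalIdeal (X.presheaf.stalk x)) (X.presheaf.stalk x))
      ((f.stalkMap x).hom a) =
        e₀ (Ideal.Quotient.mk _ (MvPowerSeries.C (algebraMap _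
          (AdicCompletion (maximalIdeal (Y.presheaf.stalk (f x))) (Y.presheaf.stalk (f x)))
            a))) := by
    rw [hC]
    exact (complMap_algebraMap (algebraMap A B) a).symm
  rw [RingEquiv.trans_apply, h1, RingEquiv.symm_apply_apply,
    DeJong1996.NodeDeformationRing.congr_mk_C]

end Summit.ResolutionOfSingularities.ResolutionOfSingularities.Theorems

end
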